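import Summits.Ventures.YMGap.FlowData.TwoDimTorelonEquality
import Summits.Ventures.YMGap.FlowData.TubeVacuumSector
import Summits.Ventures.YMGap.FlowData.RectTubeVacuumProjection
import Summits.Ventures.YMGap.FlowData.RectTubeCharacterLine
import HarnessLib

/-!
# Venture YMGap, track Y3 FLOW-DATA — THE d = 2 EQUALITY FOR `m′`: on the circle `(ℤ/L)¹` the typed `e = 0` gap is
# EXACTLY `m′(β) = L·(−ln(I₃(β)/I₁(β)))` (theorems only)

HONEST FRAMING: venture file of the cell `pub-ymgap` (QuantumFields programme), track Y3; companion of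
`TwoDimTorelonEquality` (`E₁((ℤ/L)¹; β) = L(−ln u(β))`) for the trivial-flux gap `m′` of `RectTubeVacuumProjection`
(FLOW-PLAN O5).  Theory dimension two (one spatial dimension), finite circle, exactly solvable; no number of the
FLOW-TABLE, no row, nothing about `k ≥ 2`, `L → ∞`, the continuum or a mass gap in the thermodynamic sense.  It shows
that the adjoint-torelon window of `RectTubeMassGapPrimeWindow` (`m′ ≤ (Ls μ)(−ln(I₃/I₁)) + 2β#P + ln 2`) is saturated
in `d = 2` up to the `ln 2`.

THE COMPUTATION.  By the spectral resolution of the circle transfer operator (`CircleSpectralResolution`),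
`T = Σ_n (c_n(β)/(n+1))^L |φ_n⟩⟨φ_n|` on the holonomy characters `φ_n = χ_n ∘ hol`, with `C φ_n = (−1)^n φ_n`.  The vacuum
is `φ_0 = 1` (`P_Ω = ⟪φ_0, ·⟫ φ_0` by Jentzsch simplicity), the trivial-flux sector is the closed span of the even
characters, so `T ∘ (P_0 − P_Ω)` is diagonal with eigenvalues `(c_n/(n+1))^L`, `n = 2, 4, …`, the largest being `n = 2`:
`‖T ∘ (P_0 − P_Ω)‖ = ((I₂−I₄)(β)/3)^L`, `‖T‖ = ((I₀−I₂)(β))^L`, and `(I₂−I₄)/(3(I₀−I₂)) = I₃/I₁`.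

* `inner_holCharacter_eq_zero_of_even_sector` — odd characters are invisible on twist-invariant vectors;
* `norm_tubeTransferOperator_apply_le_of_even_orth` — `‖Tχ‖ ≤ ((I₂−I₄)/3)^L ‖χ‖` for twist-invariant `χ ⊥ φ_0`;
* `vacuumProjection_sliceOne_eq` — `P_Ω ψ = ⟪φ_0, ψ⟫ φ_0` on the circle;
* **`su2_excitedSectorNorm_sliceOne_eq`** — `‖T ∘ (P_0 − P_Ω)‖ = ((I₂(β)−I₄(β))/3)^L`;
* **`su2RectMassGapPrime_sliceOne_eq`** — `su2RectMassGapPrime β (fun _ : Fin 1 => L) = L·(−log(I₃(β)/I₁(β)))` (`β > 0`, `L ≥ 1`).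

References: I. Montvay, G. Münster (1994) §3.2.6 [cite: MontvayMunster1994, §3.2.6]; M. Reed, B. Simon IV (1978) §XIII.12
[cite: ReedSimonIV1978, §XIII.12].
-/

noncomputable section

open scoped BigOperators ENNReal InnerProductSpace
open MeasureTheory Filter Function Polynomial.Chebyshev
open Literature.MathematicalPhysics.QuantumFieldTheory Literature.Analysis.OperatorTheory Literature.Analysis.FunctionSpaces
open Literature.MathematicalPhysics.QuantumLattice (fundamentalRep continuous_fundamentalRep fundamentalRep_mem_unitaryGroup)
open Summit.Ventures.LatticeQCDFlow.Exactness Summit.Ventures.LatticeQCDFlow.Scoring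

namespace Summit.Ventures.YMGap.FlowData

section Circle

variable {L : ℕ} [NeZero L]

/-- **Odd characters are invisible on the trivial-flux sector**: if `C_{ê₀} χ = χ` and `n` is odd, `⟪φ_n, χ⟫ = 0`.
[cite: tHooft1979Flux] -/
theorem inner_holCharacter_eq_zero_of_even_sector {n : ℕ} (hn : Odd n)
    {χ : Lp ℝ 2 (sliceMeasure (Matrix.specialUnitaryGroup (Fin 2) ℂ) 1 L)}
    (hχ : fluxTwistOp 1 L su2MinusOne (Pi.single 0 1) χ = χ) :
    @inner ℝ _ _ ((memLp_holCharacter (L := L) n).toLp _) χ = 0 := by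
  have hC := fluxTwistOp_holCharacter (L := L) n (Pi.single 0 1)
  rw [Pi.single_eq_same, if_pos rfl, hn.neg_one_pow] at hC
  have hsa := (ContinuousLinearMap.isSelfAdjoint_iff_isSymmetric.1
    (isSelfAdjoint_fluxTwistOp (k := 1) (L := L) su2MinusOne su2MinusOne_mul_self (Pi.single 0 1)))
    ((memLp_holCharacter (L := L) n).toLp _) χ
  change @inner ℝ _ _ (fluxTwistOp 1 L su2MinusOne (Pi.single 0 1) ((memLp_holCharacter (L := L) n).toLp _)) χ =
    @inner ℝ _ _ ((memLp_holCharacter (L := L) n).toLp _) (fluxTwistOp 1 L su2MinusOne (Pi.single 0 1) χ) at hsa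
  rw [hC, hχ, inner_smul_left] at hsa
  simp only [map_neg, map_one, neg_mul, one_mul] at hsa
  linarith

/-- **The circle transfer operator on the excited trivial-flux space**: for `χ` with `C_{ê₀} χ = χ` and `⟪φ_0, χ⟫ = 0`,
`‖T χ‖ ≤ ((I₂(β)−I₄(β))/3)^L ‖χ‖` (only even characters `n ≥ 2` see `χ`; the eigenvalue list is antitone).
[cite: MontvayMunster1994, §3.2.6] -/
theorem norm_tubeTransferOperator_apply_le_of_even_orth {β : ℝ} (hβ : 0 < β)
    {χ : Lp ℝ 2 (sliceMeasure (Matrix.specialUnitaryGroup (Fin 2) ℂ) 1 L)}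
    (hχ : fluxTwistOp 1 L su2MinusOne (Pi.single 0 1) χ = χ)
    (h0 : @inner ℝ _ _ ((memLp_holCharacter (L := L) 0).toLp _) χ = 0) :
    ‖tubeTransferOperator (fundamentalRep (Fin 2)) (β / 2) 1 L χ‖ ≤ ((besselI 2 β - besselI (2 + 2) β) / (2 + 1)) ^ L * ‖χ‖ := by
  set ev : ℕ → ℝ := fun n => ((besselI n β - besselI (n + 2) β) / (n + 1)) ^ L with hev
  set lam : ℝ := ((besselI 2 β - besselI (2 + 2) β) / (2 + 1)) ^ L with hlam
  set Φ : ℕ → Lp ℝ 2 (sliceMeasure (Matrix.specialUnitaryGroup (Fin 2) ℂ) 1 L) := fun n =>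
    (memLp_holCharacter (L := L) n).toLp _ with hΦ
  have hΦon : Orthonormal ℝ Φ := orthonormal_holCharacter (L := L)
  have hx := hasSum_tubeTransferOperator_sliceOne (L := L) hβ χ
  change HasSum (fun n => (ev n * @inner ℝ _ _ (Φ n) χ) • Φ n) _ at hx
  have hq0 : 0 ≤ (besselI 2 β - besselI (2 + 2) β) / (2 + 1) :=
    div_nonneg (besselISub_nonneg hβ.le 2) (by norm_num)
  have hcoef : ∀ n, (ev n * @inner ℝ _ _ (Φ n) χ) ^ 2 ≤ lam ^ 2 * ‖@inner ℝ _ _ (Φ n) χ‖ ^ 2 := by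
    intro n
    rcases Nat.even_or_odd n with hn | hn
    · rcases Nat.eq_zero_or_pos n with h0n | hpos
      · subst h0n
        rw [show @inner ℝ _ _ (Φ 0) χ = 0 from h0, mul_zero, norm_zero]
        simp
      · have h2 : 2 ≤ n := by
          rcases hn with ⟨m, rfl⟩
          omega
        have hevle : ev n ≤ lam := by
          have h := besselISub_div_succ_antitone hβ h2
          exact pow_le_pow_left₀ (div_nonneg (besselISub_nonneg hβ.le n) (by positivity)) (by push_cast at h ⊢; exact h) L
        rw [mul_pow, Real.norm_eq_abs, sq_abs]
        exact mul_le_mul_of_nonneg_right (pow_le_pow_left₀ (eigenvalue_sliceOne_nonneg hβ.le n) hevle 2) (sq_nonneg _)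
    · rw [show @inner ℝ _ _ (Φ n) χ = 0 from inner_holCharacter_eq_zero_of_even_sector (L := L) hn hχ, mul_zero, norm_zero]
      simp
  have hB := hΦon.tsum_inner_products_le χ
  have hBs := hΦon.inner_products_summable χ
  have hsq : ‖tubeTransferOperator (fundamentalRep (Fin 2)) (β / 2) 1 L χ‖ ^ 2 ≤ (lam * ‖χ‖) ^ 2 := by
    rw [norm_sq_eq_tsum_of_hasSum_orthonormal hΦon hx]
    calc ∑' n, (ev n * @inner ℝ _ _ (Φ n) χ) ^ 2 ≤ ∑' n, lam ^ 2 * ‖@inner ℝ _ _ (Φ n) χ‖ ^ 2 :=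
          Summable.tsum_le_tsum hcoef (Summable.of_nonneg_of_le (fun n => sq_nonneg _) hcoef (hBs.mul_left _))
            (hBs.mul_left _)
      _ = lam ^ 2 * ∑' n, ‖@inner ℝ _ _ (Φ n) χ‖ ^ 2 := tsum_mul_left
      _ ≤ lam ^ 2 * ‖χ‖ ^ 2 := mul_le_mul_of_nonneg_left hB (sq_nonneg _)
      _ = (lam * ‖χ‖) ^ 2 := by ring
  exact (pow_le_pow_iff_left₀ (norm_nonneg _) (mul_nonneg (pow_nonneg hq0 L) (norm_nonneg _)) two_ne_zero).1 hsq

/-- `∫ e^{(β/2) Re tr U} dU = (I₀(β) − I₂(β))/1` (`β ≥ 0`). [cite: MontvayMunster1994, §3.2.6] -/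
theorem su2_weightMass_half_eq_besselISub {β : ℝ} (hβ : 0 ≤ β) :
    (∫ g : Matrix.specialUnitaryGroup (Fin 2) ℂ, Real.exp (β / 2 * ((fundamentalRep (Fin 2) g).trace).re)
      ∂haarProbability (Matrix.specialUnitaryGroup (Fin 2) ℂ)) = (besselI 0 β - besselI (0 + 2) β) / ((0 : ℕ) + 1) := by
  have h1 : (∫ g : Matrix.specialUnitaryGroup (Fin 2) ℂ, Real.exp (β / 2 * ((fundamentalRep (Fin 2) g).trace).re)
      ∂haarProbability (Matrix.specialUnitaryGroup (Fin 2) ℂ)) =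
      ∫ g : Matrix.specialUnitaryGroup (Fin 2) ℂ, Real.exp (β * su2a0 g) ∂haarProbability (Matrix.specialUnitaryGroup (Fin 2) ℂ) :=
    integral_congr_ae (Eventually.of_forall fun U => by simp only [su2_weight_eq]; ring_nf)
  rw [h1]
  have h := su2_integral_exp_mul_chebyshevU_mul hβ 0 1
  simp only [Nat.cast_zero, U_zero, Polynomial.eval_one, mul_one] at h ⊢
  exact h

/-- **On the circle the vacuum projection is `⟪φ_0, ·⟫ φ_0`** (`φ_0 = χ_0 ∘ hol = 1` is a unit top eigenvector and the
top eigenvalue `c₀^L = ‖T‖` is simple by Jentzsch). [cite: ReedSimonIV1978, §XIII.12] -/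
theorem vacuumProjection_sliceOne_eq {β : ℝ} (hβ : 0 < β)
    (ψ : Lp ℝ 2 (sliceMeasure (Matrix.specialUnitaryGroup (Fin 2) ℂ) 1 L)) :
    vacuumProjection (tubeTransferOperator (fundamentalRep (Fin 2)) (β / 2) 1 L) ψ =
      (@inner ℝ _ _ ((memLp_holCharacter (L := L) 0).toLp _) ψ) • (memLp_holCharacter (L := L) 0).toLp _ := by
  haveI : SecondCountableTopology (Matrix.specialUnitaryGroup (Fin 2) ℂ) :=
    Summit.Ventures.LatticeQCDFlow.Scoring.secondCountableTopology_su2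
  set T := tubeTransferOperator (fundamentalRep (Fin 2)) (β / 2) 1 L with hT
  set Φ0 : Lp ℝ 2 (sliceMeasure (Matrix.specialUnitaryGroup (Fin 2) ℂ) 1 L) := (memLp_holCharacter (L := L) 0).toLp _
    with hΦ0
  have h1 : ‖Φ0‖ = 1 := (orthonormal_holCharacter (L := L)).1 0
  have hnorm : ‖T‖ = ((besselI 0 β - besselI (0 + 2) β) / ((0 : ℕ) + 1)) ^ L := by
    rw [hT, norm_tubeTransferOperator_sliceOne (fundamentalRep (Fin 2)) (β / 2) (continuous_fundamentalRep (Fin 2))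
      fundamentalRep_mem_unitaryGroup, su2_weightMass_half_eq_besselISub hβ.le]
  have heig : T Φ0 = ‖T‖ • Φ0 := by
    rw [hnorm, hΦ0, hT]
    have h := tubeTransferOperator_holCharacter (L := L) hβ 0
    simp only [Nat.cast_zero] at h ⊢
    exact h
  obtain ⟨φ₀, hφ1, -, -, hsimple, -⟩ := exists_vacuum (fundamentalRep (Fin 2)) (β / 2) (k := 1) (L := L)
    (continuous_fundamentalRep (Fin 2)) fundamentalRep_mem_unitaryGroup su2MinusOne_mem_center
  -- `Φ0 = a φ₀` with `a² = 1`, so `⟪Φ0, η⟫ Φ0 = ⟪φ₀, η⟫ φ₀`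
  have hΦa : Φ0 = (@inner ℝ _ _ φ₀ Φ0) • φ₀ := hsimple Φ0 heig
  have ha2 : (@inner ℝ _ _ φ₀ Φ0) ^ 2 = 1 := by
    have h := congrArg (fun v => ‖v‖ ^ 2) hΦa
    simp only [norm_smul, Real.norm_eq_abs, hφ1, mul_one, h1, sq_abs] at h
    rw [one_pow] at h
    exact h.symm
  have hsimple' : ∀ η, T η = ‖T‖ • η → η = (@inner ℝ _ _ Φ0 η) • Φ0 := by
    intro η hη
    rw [hsimple η hη]
    conv_rhs => rw [hΦa]
    rw [real_inner_smul_left, real_inner_smul_right, real_inner_self_eq_norm_sq, hφ1, one_pow, mul_one, smul_smul,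
      show @inner ℝ _ _ φ₀ Φ0 * @inner ℝ _ _ φ₀ η * @inner ℝ _ _ φ₀ Φ0 =
        (@inner ℝ _ _ φ₀ Φ0) ^ 2 * @inner ℝ _ _ φ₀ η by ring, ha2, one_mul]
  exact vacuumProjection_eq_of_simple T h1 heig hsimple' ψ

set_option maxHeartbeats 400000 in
/-- **Upper bound `‖T ∘ (P_0 − P_Ω)‖ ≤ ((I₂(β)−I₄(β))/3)^L` on the circle**: `P_0 ψ − ⟪φ_0, ψ⟫ φ_0` is twist invariant,
orthogonal to `φ_0` and no longer than `ψ`. [cite: MontvayMunster1994, §3.2.6] -/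
theorem su2_excitedSectorNorm_sliceOne_le {β : ℝ} (hβ : 0 < β) :
    excitedSectorNorm (tubeTransferOperator (fundamentalRep (Fin 2)) (β / 2) 1 L) (fluxTwistOp 1 L su2MinusOne) ≤
      ((besselI 2 β - besselI (2 + 2) β) / (2 + 1)) ^ L := by
  haveI : SecondCountableTopology (Matrix.specialUnitaryGroup (Fin 2) ℂ) :=
    Summit.Ventures.LatticeQCDFlow.Scoring.secondCountableTopology_su2
  set T := tubeTransferOperator (fundamentalRep (Fin 2)) (β / 2) 1 L with hT
  set Φ : ℕ → Lp ℝ 2 (sliceMeasure (Matrix.specialUnitaryGroup (Fin 2) ℂ) 1 L) := fun n =>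
    (memLp_holCharacter (L := L) n).toLp _ with hΦ
  set lam : ℝ := ((besselI 2 β - besselI (2 + 2) β) / (2 + 1)) ^ L with hlam
  have h1 : ‖Φ 0‖ = 1 := (orthonormal_holCharacter (L := L)).1 0
  have hlam0 : 0 ≤ lam := pow_nonneg (div_nonneg (besselISub_nonneg hβ.le 2) (by norm_num)) L
  have hvac : ∀ ψ, vacuumProjection T ψ = (@inner ℝ _ _ (Φ 0) ψ) • Φ 0 := vacuumProjection_sliceOne_eq (L := L) hβ
  have hinv0 : ∀ s : Fin 1 → ZMod 2, fluxTwistOp 1 L su2MinusOne s (Φ 0) = Φ 0 := by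
    intro s
    have h := fluxTwistOp_holCharacter (L := L) 0 s
    rw [pow_zero, ite_self, one_smul] at h
    exact h
  have hP0Φ : tubeFluxProjection su2MinusOne 1 L 0 (Φ 0) = Φ 0 := by
    rw [tubeFluxProjection_apply_of_invariant su2MinusOne hinv0, if_pos rfl]
  unfold excitedSectorNorm
  rw [show fluxProjection (fluxTwistOp 1 L su2MinusOne) 0 = tubeFluxProjection su2MinusOne 1 L 0 from rfl]
  refine ContinuousLinearMap.opNorm_le_bound _ hlam0 fun ψ => ?_
  rw [ContinuousLinearMap.comp_apply]
  simp only [FunLike.coe_sub, Pi.sub_apply]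
  rw [hvac ψ]
  have hsa := isSelfAdjoint_tubeFluxProjection (k := 1) (L := L) su2MinusOne su2MinusOne_mul_self 0
  have hinnerP : @inner ℝ _ _ (Φ 0) (tubeFluxProjection su2MinusOne 1 L 0 ψ) = @inner ℝ _ _ (Φ 0) ψ := by
    have h := (ContinuousLinearMap.isSelfAdjoint_iff_isSymmetric.1 hsa) (Φ 0) ψ
    rw [ContinuousLinearMap.coe_coe, hP0Φ] at h
    exact h.symm
  have hw0 : @inner ℝ _ _ (Φ 0) (tubeFluxProjection su2MinusOne 1 L 0 ψ - (@inner ℝ _ _ (Φ 0) ψ) • Φ 0) = 0 := by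
    rw [inner_sub_right, hinnerP, real_inner_smul_right, real_inner_self_eq_norm_sq, h1, one_pow, mul_one, sub_self]
  have hwinv : fluxTwistOp 1 L su2MinusOne (Pi.single 0 1)
      (tubeFluxProjection su2MinusOne 1 L 0 ψ - (@inner ℝ _ _ (Φ 0) ψ) • Φ 0) =
      tubeFluxProjection su2MinusOne 1 L 0 ψ - (@inner ℝ _ _ (Φ 0) ψ) • Φ 0 := by
    have hc := fluxTwistOp_comp_tubeFluxProjection (k := 1) (L := L) su2MinusOne su2MinusOne_mul_self 0 (Pi.single 0 1)
    have hsign : fluxSign (0 : Fin 1 → ZMod 2) (Pi.single 0 1) = 1 := by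
      unfold fluxSign
      rw [Fin.prod_univ_one, Pi.zero_apply, if_neg (by simp)]
    rw [hsign, one_smul] at hc
    have hc2 := congrArg (fun A => A ψ) hc
    simp only [ContinuousLinearMap.comp_apply] at hc2
    rw [map_sub, map_smul, hc2, hinv0]
  have hfactor : tubeFluxProjection su2MinusOne 1 L 0 ψ - (@inner ℝ _ _ (Φ 0) ψ) • Φ 0 =
      tubeFluxProjection su2MinusOne 1 L 0 (ψ - (@inner ℝ _ _ (Φ 0) ψ) • Φ 0) := by
    rw [map_sub, map_smul, hP0Φ]
  have hnorm : ‖tubeFluxProjection su2MinusOne 1 L 0 ψ - (@inner ℝ _ _ (Φ 0) ψ) • Φ 0‖ ≤ ‖ψ‖ := by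
    rw [hfactor]
    calc ‖tubeFluxProjection su2MinusOne 1 L 0 (ψ - (@inner ℝ _ _ (Φ 0) ψ) • Φ 0)‖
        ≤ ‖tubeFluxProjection su2MinusOne 1 L 0‖ * ‖ψ - (@inner ℝ _ _ (Φ 0) ψ) • Φ 0‖ := ContinuousLinearMap.le_opNorm _ _
      _ ≤ 1 * ‖ψ‖ := mul_le_mul (norm_fluxProjection_le_one (fun s => norm_fluxTwistOp_le_one (k := 1) (L := L)
            su2MinusOne s) 0) (inner_sub_inner_smul_eq_zero_and_norm_le h1 ψ).2 (norm_nonneg _) zero_le_one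
      _ = ‖ψ‖ := one_mul _
  calc ‖T (tubeFluxProjection su2MinusOne 1 L 0 ψ - (@inner ℝ _ _ (Φ 0) ψ) • Φ 0)‖
      ≤ lam * ‖tubeFluxProjection su2MinusOne 1 L 0 ψ - (@inner ℝ _ _ (Φ 0) ψ) • Φ 0‖ :=
        norm_tubeTransferOperator_apply_le_of_even_orth (L := L) hβ hwinv hw0
    _ ≤ lam * ‖ψ‖ := mul_le_mul_of_nonneg_left hnorm hlam0

/-- **Lower bound `((I_n−I_{n+2})(β)/(n+1))^L ≤ ‖T ∘ (P_0 − P_Ω)‖` for every even `n ≠ 0`** (test on the eigenvector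
`φ_n`, which lies in the excited trivial-flux space). [cite: MontvayMunster1994, §3.2.6] -/
theorem su2_excitedSectorNorm_sliceOne_ge {β : ℝ} (hβ : 0 < β) {n : ℕ} (hn : Even n) (hn0 : n ≠ 0) :
    ((besselI n β - besselI (n + 2) β) / (n + 1)) ^ L ≤
      excitedSectorNorm (tubeTransferOperator (fundamentalRep (Fin 2)) (β / 2) 1 L) (fluxTwistOp 1 L su2MinusOne) := by
  haveI : SecondCountableTopology (Matrix.specialUnitaryGroup (Fin 2) ℂ) :=
    Summit.Ventures.LatticeQCDFlow.Scoring.secondCountableTopology_su2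
  set T := tubeTransferOperator (fundamentalRep (Fin 2)) (β / 2) 1 L with hT
  set Φ : ℕ → Lp ℝ 2 (sliceMeasure (Matrix.specialUnitaryGroup (Fin 2) ℂ) 1 L) := fun n =>
    (memLp_holCharacter (L := L) n).toLp _ with hΦ
  have hΦon : Orthonormal ℝ Φ := orthonormal_holCharacter (L := L)
  have hon := orthonormal_iff_ite.1 hΦon
  have hvac : ∀ ψ, vacuumProjection T ψ = (@inner ℝ _ _ (Φ 0) ψ) • Φ 0 := vacuumProjection_sliceOne_eq (L := L) hβ
  have hinv : ∀ s : Fin 1 → ZMod 2, fluxTwistOp 1 L su2MinusOne s (Φ n) = Φ n := by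
    intro s
    have h := fluxTwistOp_holCharacter (L := L) n s
    rw [hn.neg_one_pow, ite_self, one_smul] at h
    exact h
  have hP0Φ : tubeFluxProjection su2MinusOne 1 L 0 (Φ n) = Φ n := by
    rw [tubeFluxProjection_apply_of_invariant su2MinusOne hinv, if_pos rfl]
  unfold excitedSectorNorm
  rw [show fluxProjection (fluxTwistOp 1 L su2MinusOne) 0 = tubeFluxProjection su2MinusOne 1 L 0 from rfl]
  have e1 : (T.comp (tubeFluxProjection su2MinusOne 1 L 0 - vacuumProjection T)) (Φ n) =
      T (tubeFluxProjection su2MinusOne 1 L 0 (Φ n) - vacuumProjection T (Φ n)) := rfl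
  have happ : (T.comp (tubeFluxProjection su2MinusOne 1 L 0 - vacuumProjection T)) (Φ n) =
      (((besselI n β - besselI (n + 2) β) / (n + 1)) ^ L) • Φ n := by
    rw [e1, hvac (Φ n), hon 0 n, if_neg (Ne.symm hn0), zero_smul, sub_zero, hP0Φ]
    exact tubeTransferOperator_holCharacter (L := L) hβ n
  have h3 : ‖(T.comp (tubeFluxProjection su2MinusOne 1 L 0 - vacuumProjection T)) (Φ n)‖ =
      ((besselI n β - besselI (n + 2) β) / (n + 1)) ^ L := by
    rw [happ, norm_smul, Real.norm_eq_abs, abs_of_nonneg (eigenvalue_sliceOne_nonneg hβ.le n), hΦon.1 n, mul_one]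
  calc ((besselI n β - besselI (n + 2) β) / (n + 1)) ^ L
      = ‖(T.comp (tubeFluxProjection su2MinusOne 1 L 0 - vacuumProjection T)) (Φ n)‖ := h3.symm
    _ ≤ ‖T.comp (tubeFluxProjection su2MinusOne 1 L 0 - vacuumProjection T)‖ * ‖Φ n‖ :=
        ContinuousLinearMap.le_opNorm _ _
    _ = ‖T.comp (tubeFluxProjection su2MinusOne 1 L 0 - vacuumProjection T)‖ := by rw [hΦon.1 n, mul_one]

/-- **THE EXCITED TRIVIAL-FLUX NORM OF THE CIRCLE, EXACTLY**: `‖T ∘ (P_0 − P_Ω)‖ = ((I₂(β)−I₄(β))/3)^L` (`β > 0`).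
[cite: MontvayMunster1994, §3.2.6] -/
theorem su2_excitedSectorNorm_sliceOne_eq {β : ℝ} (hβ : 0 < β) :
    excitedSectorNorm (tubeTransferOperator (fundamentalRep (Fin 2)) (β / 2) 1 L) (fluxTwistOp 1 L su2MinusOne) =
      ((besselI 2 β - besselI (2 + 2) β) / (2 + 1)) ^ L := by
  refine le_antisymm (su2_excitedSectorNorm_sliceOne_le (L := L) hβ) ?_
  have h := su2_excitedSectorNorm_sliceOne_ge (L := L) hβ (show Even (2 : ℕ) from ⟨1, rfl⟩) two_ne_zero
  push_cast at h
  exact h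

/-- **THE d = 2 EQUALITY FOR `m′`.**  On the circle `(ℤ/L)¹` (theory dimension two) the cell's typed `e = 0` gap IS
`su2RectMassGapPrime β (fun _ : Fin 1 => L) = L · (−log(I₃(β)/I₁(β)))` for every `L ≥ 1` and `β > 0`
(`(I₂−I₄)/(3(I₀−I₂)) = I₃/I₁`): the adjoint-torelon scale, exactly. [cite: MontvayMunster1994, §3.2.6] -/
theorem su2RectMassGapPrime_sliceOne_eq {β : ℝ} (hβ : 0 < β) (L : ℕ) [NeZero L] :
    su2RectMassGapPrime β (fun _ : Fin 1 => L) = (L : ℝ) * (-Real.log (besselI 3 β / besselI 1 β)) := by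
  haveI : SecondCountableTopology (Matrix.specialUnitaryGroup (Fin 2) ℂ) :=
    Summit.Ventures.LatticeQCDFlow.Scoring.secondCountableTopology_su2
  have hIpos : ∀ n : ℕ, 0 < besselI n β := fun n => by
    rw [besselI_eq_latticeModels_besselI]; exact Literature.Probability.LatticeModels.besselI_pos hβ _
  set c0 : ℝ := (besselI 0 β - besselI (0 + 2) β) / ((0 : ℕ) + 1) with hc0
  set q2 : ℝ := (besselI 2 β - besselI (2 + 2) β) / (2 + 1) with hq2
  have hc0pos : 0 < c0 := by
    rw [hc0, besselISub_div_succ hβ.ne' 0]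
    exact div_pos (mul_pos two_pos (hIpos (0 + 1))) hβ
  have hq2pos : 0 < q2 := by
    have h := besselISub_div_succ hβ.ne' 2
    push_cast at h
    rw [hq2, h]
    exact div_pos (mul_pos two_pos (hIpos (2 + 1))) hβ
  have hnorm : ‖tubeTransferOperator (fundamentalRep (Fin 2)) (β / 2) 1 L‖ = c0 ^ L := by
    rw [norm_tubeTransferOperator_sliceOne (fundamentalRep (Fin 2)) (β / 2) (continuous_fundamentalRep (Fin 2))
      fundamentalRep_mem_unitaryGroup, su2_weightMass_half_eq_besselISub hβ.le]
  have key : Real.log c0 - Real.log q2 = -Real.log (besselI 3 β / besselI 1 β) := by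
    rw [← Real.log_div hc0pos.ne' hq2pos.ne', ← Real.log_inv]
    congr 1
    have h2 := besselISub_div_succ hβ.ne' 2
    push_cast at h2
    rw [hc0, hq2, besselISub_div_succ hβ.ne' 0, h2]
    have hI1 : besselI (0 + 1) β ≠ 0 := (hIpos (0 + 1)).ne'; have hI3 : besselI (2 + 1) β ≠ 0 := (hIpos (2 + 1)).ne'
    field_simp
  change massGapPrime (tubeTransferOperator (fundamentalRep (Fin 2)) (β / 2) 1 L) (fluxTwistOp 1 L su2MinusOne) = _
  unfold massGapPrime
  rw [su2_excitedSectorNorm_sliceOne_eq hβ, hnorm, Real.log_pow, Real.log_pow, ← hq2, ← mul_sub, key]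

end Circle

end Summit.Ventures.YMGap.FlowData
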